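import Literature.AlgebraicGeometry.Frobenioids.PreFrobenioidDataOfFunctor
import Literature.AlgebraicGeometry.Frobenioids.DivisorMonoidCategoryTheoreticityDefs
import Literature.AlgebraicGeometry.Frobenioids.CharacteristicSplitting
import Literature.AlgebraicGeometry.Frobenioids.PerfFactorial
import Literature.AlgebraicGeometry.Frobenioids.FiniteEtaleBase
import HarnessLib

/-!
# Frobenioids II, Theorem 3.6 (i), (ii): the clauses in the vocabulary of [FrdI] §2–§4
# (characteristic splitting, standard type, rationally standard type)

Mochizuki, *The geometry of Frobenioids II: poly-Frobenioids*, Kyushu J. Math. **62** (2008)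
401–460, §3, Theorem 3.6 (i), (ii), author's kurims text pp. 36–37 [cite: MochizukiFrdII2008, Thm 3.6 pp.36-37]:

> (i) "… the canonical decomposition of Definition 3.1, (ii), determines a characteristic splitting
> [cf. [FrdI], Definition 2.3] on `C^Λ`. … If, moreover, `D` is of FSMFF- and RC-iso-subanchor type, then
> `C^Λ` is of rationally standard type."
> (ii) "… If, moreover, `D` is of FSMFF- and RC-iso-subanchor type, then `A` is of standard [but not of
> rationally standard] type."

This is the companion of `ArchimedeanBasicProperties.lean` (which types the clauses of Theorem 3.6 that
live in the typology of [FrdI] Def. 1.2 and [FrdI]/[FrdII] §0). The three clauses above speak the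
language of [FrdI] §2–§4, typed in the cell by other seats: "characteristic splitting" = [FrdI] Def. 2.3
(`PreFrobenioid.CharacteristicSplitting`, `CharacteristicSplitting.lean`, seat abc-iut-L1-t2); "standard
type" = [FrdI] Def. 3.1 (i) (`PreFrobenioidData.IsOfStandardType`, seat abc-iut-L1-t3); "rationally
standard type" = [FrdI] Def. 4.5 (iii) (`PreFrobenioidData.IsOfRationallyStandardType`, over the
parameter bundle `R : RSParams` — birationalization, support predicate, unit-trivialisation data —
exactly as that file parametrizes it, seat abc-iut-L1-t3); the operations `(Base, Div, deg_Fr)` of a structure functor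
`F : X → F_Φ` are read through the adapter `PreFrobenioidData.ofFunctor Φ F`. As in the companion file,
each clause is a named `Prop`-valued PREDICATE of the structure it speaks about (`G : D → D₀ = ArchBase`
with [FrdII] Def. 3.1 (v) `RC.IsOfRCIsoSubanchorType`, the structure functor `F`, and the §2–§4 data);
the printed CLAIM is its value at the archimedean / angular Frobenioids of Example 3.3 (seat
abc-iut-L1-t6), recorded in `ArchimedeanTheoremsInstances.lean`. "The canonical decomposition … determines
a characteristic splitting" is typed as: there is a characteristic splitting whose submonoids `τ(A)`, for
isotropic `A`, are exactly the radial endomorphisms (parameter `radial`, the same predicate as in Thm. 3.6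
(iii) of the companion file). No statement of the paper is strengthened; typed ≠ proved.
-/

namespace Literature.AlgebraicGeometry.Frobenioids

open CategoryTheory

universe w v v' u u'

namespace ArchFrd

variable {D : Type u} [Category.{v} D] (G : D ⥤ ArchBase)
  {Φ : Dᵒᵖ ⥤ CommMonCat.{w}} {X : Type u'} [Category.{v'} X] (F : X ⥤ ElemFrobenioid Φ)

/-- **Theorem 3.6 (i)**, characteristic-splitting clause (FrdII p. 36), for `F = C^Λ → F_Φ`: "the
canonical decomposition of Definition 3.1, (ii), determines a characteristic splitting [cf. [FrdI],
Definition 2.3] on `C^Λ`": there is a characteristic splitting `τ` on `F` ([FrdI] Def. 2.3,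
`PreFrobenioid.CharacteristicSplitting`) with `τ(A)` = the radial endomorphisms of `A` (the factor
`ord(K^×) ≅ ℝ_{>0}` of the canonical decomposition `O_K^× × ord(K^×) ⥲ K^×`) for every isotropic `A`.
[cite: MochizukiFrdII2008, Thm 3.6 (i) p.36] -/
def Thm36i_charSplitting (radial : ∀ A : X, (A ⟶ A) → Prop) : Prop :=
  ∃ τ : PreFrobenioid.CharacteristicSplitting F,
    ∀ A : X, PreFrobenioid.IsIsotropic F A → ∀ t : End A, t ∈ τ.τ A ↔ radial A t

section RationallyStandard

variable (R : (PreFrobenioidData.ofFunctor Φ F).RSParams)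

/-- **Theorem 3.6 (i)**, last clause (FrdII p. 36), for `F = C^Λ → F_Φ` over `G : D → D₀`: "If,
moreover, `D` is of FSMFF- and RC-iso-subanchor type, then `C^Λ` is of rationally standard type"
([FrdI] Def. 4.5 (iii), `PreFrobenioidData.IsOfRationallyStandardType`, over the parameter bundle
`R : RSParams` of that definition — birationalization `C^birat`, support predicate, the operations and
birationalization of `C^un-tr` — read for the operations `PreFrobenioidData.ofFunctor Φ F` of `F`).
[cite: MochizukiFrdII2008, Thm 3.6 (i) p.36] -/
def Thm36i_rationallyStandard : Prop :=
  IsOfFSMFFType D → RC.IsOfRCIsoSubanchorType G →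
    (PreFrobenioidData.ofFunctor Φ F).IsOfRationallyStandardType R

/-- **Theorem 3.6 (ii)**, last clause (FrdII p. 37), for `F = A → F_Φ` the angular Frobenioid over
`G : D → D₀`: "If, moreover, `D` is of FSMFF- and RC-iso-subanchor type, then `A` is of standard [but
not of rationally standard] type" ([FrdI] Def. 3.1 (i) `PreFrobenioidData.IsOfStandardType`; Def. 4.5
(iii) over `R : RSParams` as in (i)). [cite: MochizukiFrdII2008, Thm 3.6 (ii) p.37] -/
def Thm36ii_standard_notRationallyStandard : Prop :=
  IsOfFSMFFType D → RC.IsOfRCIsoSubanchorType G →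
    (PreFrobenioidData.ofFunctor Φ F).IsOfStandardType ∧
      ¬ (PreFrobenioidData.ofFunctor Φ F).IsOfRationallyStandardType R

end RationallyStandard

end ArchFrd

end Literature.AlgebraicGeometry.Frobenioids
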